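import Literature.Computability.AlgebraicComplexity.RelativeExponent
import HarnessLib

/-!
# Graded matrix-multiplication presentations obey the support–volume bound

`Summit.MatrixMultiplication.MatrixMultiplication.Theorems` — solo programme `solo-MatrixMultiplication-blind`
(door R: cheap presentations `T^{⊠N} ≤ ⟨a,b,c⟩` of the Kronecker powers of a fixed small tensor `T`).

A *matrix-multiplication presentation* of a tensor `T : ι → κ → ν → R` of shape `⟨A,B,C⟩` consists of three
families of matrices `α i : A × B`, `β j : B × C`, `γ k : C × A` with
`T i j k = ∑_{x,y,z} α i x y · β j y z · γ k z x` ("`T = tr(α β γ)`", i.e. `T` is a restriction of the matrix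
multiplication tensor `⟨|A|,|B|,|C|⟩`).  It is *graded* (by an additive group `G`, with weights `wA, wB, wC`
on the three bond index sets and `μ₁, μ₂, μ₃` on the three legs of `T`) when every matrix `α i` is supported
on the entries `(x,y)` with `wB y = wA x + μ₁ i`, and similarly for `β`, `γ` — exactly the shape forced by
equivariance under a one-parameter (or torus) subgroup of the stabiliser of `T` acting diagonally with
weights `μ` on the legs, the bond spaces being graded representations.

* `card_support_le_volume_of_graded` — if the three leg-weight maps are injective (distinct weights), then
  the support of `T` has at most `|A|·|B|·|C|` elements.  Proof: a nonzero entry `T i j k` forces a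
  "triangle" `(x,y,z)` with `α i x y · β j y z · γ k z x ≠ 0`; the triangle recovers `μ₁ i = wB y − wA x`,
  `μ₂ j`, `μ₃ k`, hence `(i,j,k)`; so support ↪ `A × B × C`.
* `card_support_le_volume_of_graded'` — the same with the weaker hypothesis that only `α, β` are graded
  (two injective leg-weight maps, `γ` arbitrary) but the support is *Latin* in the third leg
  (`T i j k ≠ 0 ∧ T i j k' ≠ 0 → k = k'`), as for the Coppersmith–Winograd tensors `T_{cw,2} ≅ X = xyz+…`
  and `T_{skewcw,2} = E` and all their Kronecker powers.

Consequences recorded by the programme (pen + exhaustive computation, not part of this file): the Kronecker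
power `T^{⊠N}` of `T ∈ {T_{cw,2}, T_{skewcw,2}}` has support of size `6^N` and its stabiliser contains tori
acting with `3^N` distinct weights on each leg, so every torus-graded cubic presentation `T^{⊠N} ≤ ⟨a,a,a⟩`
(restriction, or degeneration through graded families) has `a ≥ 6^{N/3}`, i.e. rate
`N⁻¹ log₃ a ≥ (log₃ 6)/3 = 0.5436… > 1/2`: the rate `1/2` ("`c(T) = 1/2`", which would make
`R̃(T) = 3 ⟺ ω = 2` an equivalence) is out of reach of graded constructions, and since a presentation
certifies only `R̃(T) ≤ a^{ω/N}` with `ω ≤ 2.3714`, no graded presentation can improve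
`R̃(T_{cw,2}) ≤ 3.931` (`3.931^{1/2.3714} = 1.781 < 6^{1/3} = 1.817`).  A finer count
(`6^N ≤ b · M_N(a,c)`, `M_N` = the largest number of coordinatewise-distinct pairs between an `a`-set and
a `c`-set of words in `[3]^N`, computed exhaustively for `N = 3` and bounded for `N = 4`) excludes every
graded cubic presentation with `a < 8 = 2^3` (`N = 3`) and `a < 14` (`N = 4`).
-/

open scoped BigOperators

set_option linter.dupNamespace false

namespace Summit.MatrixMultiplication.MatrixMultiplication.Theorems

variable {ι κ ν A B C G R : Type*}

/-- **Support–volume bound for graded presentations.**  If `T = tr(α β γ)` is a `G`-graded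
matrix-multiplication presentation of shape `⟨A,B,C⟩` whose three leg-weight maps `μ₁, μ₂, μ₃` are
injective, then `|supp T| ≤ |A|·|B|·|C|`. [new] -/
theorem card_support_le_volume_of_graded
    [Fintype A] [Fintype B] [Fintype C] [Fintype ι] [Fintype κ] [Fintype ν]
    [AddCommGroup G] [CommSemiring R] [DecidableEq R]
    (wA : A → G) (wB : B → G) (wC : C → G) (μ₁ : ι → G) (μ₂ : κ → G) (μ₃ : ν → G)
    (h₁ : Function.Injective μ₁) (h₂ : Function.Injective μ₂) (h₃ : Function.Injective μ₃)
    (α : ι → A → B → R) (β : κ → B → C → R) (γ : ν → C → A → R)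
    (hα : ∀ i x y, α i x y ≠ 0 → wB y = wA x + μ₁ i)
    (hβ : ∀ j y z, β j y z ≠ 0 → wC z = wB y + μ₂ j)
    (hγ : ∀ k z x, γ k z x ≠ 0 → wA x = wC z + μ₃ k)
    (T : ι → κ → ν → R)
    (hT : ∀ i j k, T i j k = ∑ x, ∑ y, ∑ z, α i x y * β j y z * γ k z x) :
    Fintype.card {t : ι × κ × ν // T t.1 t.2.1 t.2.2 ≠ 0} ≤
      Fintype.card A * Fintype.card B * Fintype.card C := by
  classical
  have key : ∀ t : {t : ι × κ × ν // T t.1 t.2.1 t.2.2 ≠ 0}, ∃ xyz : A × B × C,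
      α t.1.1 xyz.1 xyz.2.1 ≠ 0 ∧ β t.1.2.1 xyz.2.1 xyz.2.2 ≠ 0 ∧ γ t.1.2.2 xyz.2.2 xyz.1 ≠ 0 := by
    rintro ⟨⟨i, j, k⟩, ht⟩
    have ht' : ∑ x, ∑ y, ∑ z, α i x y * β j y z * γ k z x ≠ 0 := by rw [← hT]; exact ht
    obtain ⟨x, -, hx⟩ := Finset.exists_ne_zero_of_sum_ne_zero ht'
    obtain ⟨y, -, hy⟩ := Finset.exists_ne_zero_of_sum_ne_zero hx
    obtain ⟨z, -, hz⟩ := Finset.exists_ne_zero_of_sum_ne_zero hy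
    refine ⟨(x, y, z), ?_, ?_, ?_⟩
    · intro h; apply hz; simp [h]
    · intro h; apply hz; simp [h]
    · intro h; apply hz; simp [h]
  choose f hf using key
  calc Fintype.card {t : ι × κ × ν // T t.1 t.2.1 t.2.2 ≠ 0}
      ≤ Fintype.card (A × B × C) := Fintype.card_le_of_injective f ?_
    _ = Fintype.card A * Fintype.card B * Fintype.card C := by
        simp [Fintype.card_prod, mul_assoc]
  intro s t hst
  obtain ⟨ha, hb, hc⟩ := hf s
  obtain ⟨ha', hb', hc'⟩ := hf t
  rw [hst] at ha hb hc
  have e₁ : s.1.1 = t.1.1 := h₁ (add_left_cancel ((hα _ _ _ ha).symm.trans (hα _ _ _ ha')))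
  have e₂ : s.1.2.1 = t.1.2.1 := h₂ (add_left_cancel ((hβ _ _ _ hb).symm.trans (hβ _ _ _ hb')))
  have e₃ : s.1.2.2 = t.1.2.2 := h₃ (add_left_cancel ((hγ _ _ _ hc).symm.trans (hγ _ _ _ hc')))
  exact Subtype.ext (Prod.ext e₁ (Prod.ext e₂ e₃))

/-- **Support–volume bound, Latin form.**  Same conclusion when only `α` and `β` are graded, with
injective leg-weight maps `μ₁, μ₂`, the third family `γ` being arbitrary, provided the support of `T` is
Latin in the third leg (the third index of a support entry is determined by the first two) — the case of
`T_{cw,2}`, `T_{skewcw,2}` and their Kronecker powers under any torus of the stabiliser with distinct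
weights on two legs. [new] -/
theorem card_support_le_volume_of_graded'
    [Fintype A] [Fintype B] [Fintype C] [Fintype ι] [Fintype κ] [Fintype ν]
    [AddCommGroup G] [CommSemiring R] [DecidableEq R]
    (wA : A → G) (wB : B → G) (wC : C → G) (μ₁ : ι → G) (μ₂ : κ → G)
    (h₁ : Function.Injective μ₁) (h₂ : Function.Injective μ₂)
    (α : ι → A → B → R) (β : κ → B → C → R) (γ : ν → C → A → R)
    (hα : ∀ i x y, α i x y ≠ 0 → wB y = wA x + μ₁ i)
    (hβ : ∀ j y z, β j y z ≠ 0 → wC z = wB y + μ₂ j)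
    (T : ι → κ → ν → R)
    (hLatin : ∀ i j k k', T i j k ≠ 0 → T i j k' ≠ 0 → k = k')
    (hT : ∀ i j k, T i j k = ∑ x, ∑ y, ∑ z, α i x y * β j y z * γ k z x) :
    Fintype.card {t : ι × κ × ν // T t.1 t.2.1 t.2.2 ≠ 0} ≤
      Fintype.card A * Fintype.card B * Fintype.card C := by
  classical
  have key : ∀ t : {t : ι × κ × ν // T t.1 t.2.1 t.2.2 ≠ 0}, ∃ xyz : A × B × C,
      α t.1.1 xyz.1 xyz.2.1 ≠ 0 ∧ β t.1.2.1 xyz.2.1 xyz.2.2 ≠ 0 ∧ γ t.1.2.2 xyz.2.2 xyz.1 ≠ 0 := by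
    rintro ⟨⟨i, j, k⟩, ht⟩
    have ht' : ∑ x, ∑ y, ∑ z, α i x y * β j y z * γ k z x ≠ 0 := by rw [← hT]; exact ht
    obtain ⟨x, -, hx⟩ := Finset.exists_ne_zero_of_sum_ne_zero ht'
    obtain ⟨y, -, hy⟩ := Finset.exists_ne_zero_of_sum_ne_zero hx
    obtain ⟨z, -, hz⟩ := Finset.exists_ne_zero_of_sum_ne_zero hy
    refine ⟨(x, y, z), ?_, ?_, ?_⟩
    · intro h; apply hz; simp [h]
    · intro h; apply hz; simp [h]
    · intro h; apply hz; simp [h]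
  choose f hf using key
  calc Fintype.card {t : ι × κ × ν // T t.1 t.2.1 t.2.2 ≠ 0}
      ≤ Fintype.card (A × B × C) := Fintype.card_le_of_injective f ?_
    _ = Fintype.card A * Fintype.card B * Fintype.card C := by
        simp [Fintype.card_prod, mul_assoc]
  intro s t hst
  obtain ⟨ha, hb, hc⟩ := hf s
  obtain ⟨ha', hb', hc'⟩ := hf t
  rw [hst] at ha hb hc
  have e₁ : s.1.1 = t.1.1 := h₁ (add_left_cancel ((hα _ _ _ ha).symm.trans (hα _ _ _ ha')))
  have e₂ : s.1.2.1 = t.1.2.1 := h₂ (add_left_cancel ((hβ _ _ _ hb).symm.trans (hβ _ _ _ hb')))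
  have e₃ : s.1.2.2 = t.1.2.2 := by
    apply hLatin t.1.1 t.1.2.1
    · have := s.2; rw [e₁, e₂] at this; exact this
    · exact t.2
  exact Subtype.ext (Prod.ext e₁ (Prod.ext e₂ e₃))

end Summit.MatrixMultiplication.MatrixMultiplication.Theorems
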